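import Summits.ResolutionOfSingularities.ResolutionOfSingularities.Theorems.PurelyInseparableDim4ResConeLightResidualRotation
import Summits.ResolutionOfSingularities.ResolutionOfSingularities.Theorems.PurelyInseparableDim4ShadeTwoSwapWindow
import HarnessLib
import HarnessLib.Audit.Tags

/-!
# Purely inseparable four-folds — THE K2(5) LEDGER THEOREM (K27c): K2(5) ⟺ no ISOLATED BINARY-CONE TRAP OF SHADE 3
# OR 4 (slice C), MODULO the two rotation residuals `hslotT` (K24a-R1′) and `hN4` (K24b-R1)
# (cell `res-dim4-pi`, K2(p) lane, slices B/C; K27 packaging, final form of record)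

[OURS · counted 0 · cell `res-dim4-pi` · K2(p) lane holder res-dim4-p-12 g3's K27c («append: the shade-2 conjunct DISCHARGED
by `no_isolated_shadeTwo_trap 5 K`», bus 2026-08-29 03:57:58Z) and the desk's WORD #160 («K2(5) LEDGER THEOREM OF RECORD;
d = 2 drops in p-3's append (i)»); seat res-dim4-p-3 g4.]  Nothing here proves K2(5) (`RidgeBudget.NoAboveFloorTrap 5 5`),
`NoIsolatedTrap 5 5` or resolution of singularities in dimension ≥ 4 / characteristic `p` — NOT proved.  AI kernel work,
weaker than expert review.

Composition of `…LightResidualRotation.noAboveFloorTrap_five_iff_residual_two_of_rotation` (K2(5) ⟺ no `d = 2` light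
power-cone trap ∧ no binary-cone trap of shade `2…4`, modulo `hslotT`, `hN4`) with res-dim4-p-7 g3's d = 2 PHASE
`ResCone.no_isolated_shadeTwo_trap` (p693892: NO isolated above-floor `Step0 p` chain of constant shade `2` at all — any
`e_G`, any witnesses): the `d = 2` light conjunct is TRUE and the binary-cone conjunct shrinks to shades `3, 4`.
**`noAboveFloorTrap_five_iff_sliceC_of_rotation (hslotT) (hN4) : NoAboveFloorTrap 5 5 ↔ ∀ K, ¬ ∃ (c : ℕ → State K) (d : ℕ),
3 ≤ d ≤ 4 ∧ x^{r₀} ∣ F₀ ∧ ∀ k, isolated ∧ Step0 5 ∧ ord₀ ≠ 5 ∧ shade = d ∧ e_G = 2`.**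

[cite: CossartJannsenSaito2020, Thm. 3.14] bears_on: LADDER-RESOLUTION:D157-DOOR2 (res-dim4-pi · K2(p) · K27c ledger theorem).
Supports stmt-ResolutionOfSingularities-16155 (helper).
-/

set_option linter.dupNamespace false -- mandated namespace of this single-conjunct summit

noncomputable section

namespace Summit.ResolutionOfSingularities.ResolutionOfSingularities.Theorems.PIDim4

namespace ResCone

open MvPolynomial
open Literature.AlgebraicGeometry.Resolution
open Literature.AlgebraicGeometry.Resolution.CentreBlowup
open Literature.AlgebraicGeometry.Resolution.Hauser2010
open Literature.AlgebraicGeometry.Resolution.HauserPerlega2019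
open RidgeBudget (NoAboveFloorTrap)

/-- **The `d = 2` light power-cone trap does not exist** (projection of res-dim4-p-7 g3's `no_isolated_shadeTwo_trap`
onto the slice-B dress: drop the witnesses, the `e_G` and the satellite clause). [OURS · bookkeeping] -/
theorem no_light_pair_tail_two_five (K : Type) [Field K] [CharP K 5] [DecidableEq K] :
    ¬ ∃ (c : ℕ → State K) (j : ℕ → Fin 4) (b : ℕ → Fin 4 → K),
        (∀ e' ∈ (c 0).F.support, (c 0).r ≤ e') ∧ FreeTail.IsWitnessedChain 5 c j b ∧
        (∀ k, IsIsolated 5 (c k).F ∧ Step0 5 (c k) (c (k + 1)) ∧ ordZero (c k).F ≠ (5 : ℕ) ∧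
          (c k).shade = ((2 : ℕ) : ℕ∞) ∧ Module.finrank K (resVertex (c k)) = 3) ∧
        ∀ N, ∃ k, N ≤ k ∧ FreeTail.IsSatellite j b k ∧
          ordZero (c k).F = (6 : ℕ) ∧ ordZero (c (k + 1)).F = (6 : ℕ) := by
  haveI : Fact (Nat.Prime 5) := ⟨by norm_num⟩
  rintro ⟨c, -, -, hr0, -, hk, -⟩
  exact no_isolated_shadeTwo_trap 5 K ⟨c, hr0, fun k =>
    ⟨(hk k).1, (hk k).2.1, (hk k).2.2.1, by rw [(hk k).2.2.2.1]; rfl⟩⟩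

/-- **No isolated binary-cone trap of shade `2`** either (same projection; `e_G` is not read). [OURS · bookkeeping] -/
theorem no_binary_trap_two_five (K : Type) [Field K] [CharP K 5] [DecidableEq K] :
    ¬ ∃ (c : ℕ → State K), (∀ e' ∈ (c 0).F.support, (c 0).r ≤ e') ∧
        ∀ k, IsIsolated 5 (c k).F ∧ Step0 5 (c k) (c (k + 1)) ∧ ordZero (c k).F ≠ (5 : ℕ) ∧
          (c k).shade = ((2 : ℕ) : ℕ∞) ∧ Module.finrank K (resVertex (c k)) = 2 := by
  haveI : Fact (Nat.Prime 5) := ⟨by norm_num⟩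
  rintro ⟨c, hr0, hk⟩
  exact no_isolated_shadeTwo_trap 5 K ⟨c, hr0, fun k =>
    ⟨(hk k).1, (hk k).2.1, (hk k).2.2.1, by rw [(hk k).2.2.2.1]; rfl⟩⟩

/-- **THE K2(5) LEDGER THEOREM (K27c, of record): K2(5) ⟺ NO ISOLATED BINARY-CONE TRAP OF SHADE `3` OR `4`**, modulo
the two PRESENTATION residuals — `hslotT` (K24a-R1′: a `d = 3` two-slot tail in the T-sector takes no rotation step,
res-dim4-p-1 g4) and `hN4` (K24b-R1: the C∞ block admits a rotation-free re-presentation, res-dim4-typ-1 g3).  Every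
`d = 2` conjunct is discharged by res-dim4-p-7 g3's `no_isolated_shadeTwo_trap`. [OURS]
[cite: CossartJannsenSaito2020, Thm. 3.14] -/
theorem noAboveFloorTrap_five_iff_sliceC_of_rotation
    (hslotT : ∀ (K : Type) [Field K] [CharP K 5] [DecidableEq K] (c : ℕ → State K) (j : ℕ → Fin 4)
      (b : ℕ → Fin 4 → K), (∀ k, IsIsolated 5 (c k).F ∧ Step0 5 (c k) (c (k + 1))) →
      FreeTail.IsWitnessedChain 5 c j b → (∀ e ∈ (c 0).F.support, (c 0).r ≤ e) →
      (∀ k, ordZero (c k).F ≠ (5 : ℕ)) → ∀ k₀ : ℕ, (∀ k, k₀ ≤ k → (c k).shade = ((3 : ℕ) : ℕ∞)) →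
      (∀ k, k₀ ≤ k → Module.finrank K (resVertex (c k)) = 3) →
      ∀ (ν : Fin 4) (k₁ : ℕ), k₀ ≤ k₁ → (∀ k, k₁ ≤ k → 1 ≤ (c k).r ν ∧ j k ≠ ν ∧ b k ν = 0) →
      (∀ k, k₁ ≤ k → ∀ i, i ≠ ν → 1 ≤ (c k).r i →
        ∃ t, k₀ ≤ t ∧ t < k ∧ j t = i ∧ ∀ m, t < m → m < k → j m ≠ i ∧ b m i = 0) →
      (∀ ℓ : Fin 4 → K, (∀ w, w ∈ resVertex (c k₁) ↔ dotProduct ℓ w = 0) →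
        ∀ i, (c k₁).r i = 0 → ℓ i ≠ 0) → ∀ k, k₁ ≤ k → 1 ≤ (c k).r (j k))
    (hN4 : ∀ (K : Type) [Field K] [CharP K 5] [DecidableEq K] (c : ℕ → State K) (j : ℕ → Fin 4)
      (b : ℕ → Fin 4 → K), (∀ k, IsIsolated 5 (c k).F ∧ Step0 5 (c k) (c (k + 1))) →
      FreeTail.IsWitnessedChain 5 c j b → (∀ e ∈ (c 0).F.support, (c 0).r ≤ e) →
      (∀ k, ordZero (c k).F ≠ (5 : ℕ)) → ∀ k₀ : ℕ, (∀ k, k₀ ≤ k → (c k).shade = ((4 : ℕ) : ℕ∞)) →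
      (∀ k, k₀ ≤ k → Module.finrank K (resVertex (c k)) = 3) →
      ∀ k₁ : ℕ, k₀ ≤ k₁ → (∀ k, k₀ ≤ k → (∀ i, (c k).r i ≤ 1) ∧ (c k).r.degree = 2) →
      (∀ k, k₁ ≤ k → ∀ i, 1 ≤ (c k).r i →
        ∃ t, k₀ ≤ t ∧ t < k ∧ j t = i ∧ ∀ m, t < m → m < k → j m ≠ i ∧ b m i = 0) →
      ∃ (c' : ℕ → State K) (j' : ℕ → Fin 4) (b' : ℕ → Fin 4 → K) (k₀' k₁' : ℕ),
        (∀ k, IsIsolated 5 (c' k).F ∧ Step0 5 (c' k) (c' (k + 1))) ∧ FreeTail.IsWitnessedChain 5 c' j' b' ∧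
        (∀ e ∈ (c' 0).F.support, (c' 0).r ≤ e) ∧ (∀ k, ordZero (c' k).F ≠ (5 : ℕ)) ∧
        (∀ k, k₀' ≤ k → (c' k).shade = ((4 : ℕ) : ℕ∞)) ∧
        (∀ k, k₀' ≤ k → Module.finrank K (resVertex (c' k)) = 3) ∧ k₀' ≤ k₁' ∧
        (∀ k, k₀' ≤ k → (∀ i, (c' k).r i ≤ 1) ∧ (c' k).r.degree = 2) ∧
        (∀ k, k₁' ≤ k → ∀ i, 1 ≤ (c' k).r i →
          ∃ t, k₀' ≤ t ∧ t < k ∧ j' t = i ∧ ∀ m, t < m → m < k → j' m ≠ i ∧ b' m i = 0) ∧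
        (∀ k, k₁' ≤ k → 1 ≤ (c' k).r (j' k))) :
    NoAboveFloorTrap 5 5 ↔ ∀ (K : Type) [Field K] [CharP K 5] [DecidableEq K],
      ¬ ∃ (c : ℕ → State K) (d : ℕ), 3 ≤ d ∧ d ≤ 4 ∧
          (∀ e' ∈ (c 0).F.support, (c 0).r ≤ e') ∧
          ∀ k, IsIsolated 5 (c k).F ∧ Step0 5 (c k) (c (k + 1)) ∧ ordZero (c k).F ≠ (5 : ℕ) ∧
            (c k).shade = (d : ℕ∞) ∧ Module.finrank K (resVertex (c k)) = 2 := by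
  rw [noAboveFloorTrap_five_iff_residual_two_of_rotation hslotT hN4]
  refine forall_congr' fun K => forall_congr' fun _ => forall_congr' fun _ => forall_congr' fun _ => ?_
  constructor
  · rintro ⟨-, h⟩ ⟨c, d, h3, h4, hr0, hk⟩
    exact h ⟨c, d, by omega, h4, hr0, hk⟩
  · intro h
    refine ⟨no_light_pair_tail_two_five K, ?_⟩
    rintro ⟨c, d, h2, h4, hr0, hk⟩
    by_cases hd : d = 2
    · subst hd
      exact no_binary_trap_two_five K ⟨c, hr0, hk⟩
    · exact h ⟨c, d, by omega, h4, hr0, hk⟩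

end ResCone

end Summit.ResolutionOfSingularities.ResolutionOfSingularities.Theorems.PIDim4

end
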